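import Literature.NumberTheory.LFunctions.ZetaScrew
import Literature.NumberTheory.LFunctions.ZetaScrewSlackLandau
import Summits.RiemannHypothesis.RiemannHypothesis.Theorems.SparseScrewLandauQuarticSampleLandauPrimeSumConvex
import Summits.RiemannHypothesis.RiemannHypothesis.Theorems.SparseScrewLandauQuarticSampleLandauSmoothDefect
import Summits.RiemannHypothesis.RiemannHypothesis.Theses.SparseScrewLandau
import HarnessLib

/-!
# Crux `SparseScrewLandau.QuarticSampleLandau` (stmt-RiemannHypothesis-23405) — quartic-sample Landau
detection for Suzuki's screw function (RH-free criterion, K1 of route `SparseScrewLandau`, L41)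

**Theorem (`QuarticSampleLandau_proof`).** If Suzuki's screw function `Ψ = zetaScrew`
(Suzuki 2023, arXiv:2206.03682, (1.1)) is bounded below on the quartic sample set,
`Ψ(4 log n) ≥ -K` for all `n ≥ 1` (i.e. at `x = n⁴` in the variable `x = e^t`), then the Riemann
Hypothesis holds.

This is a NEW RH-CRITERION, not a proof of RH: the hypothesis (the route's residual conjunct
`QuarticSampleFloor`, stmt-RiemannHypothesis-23406) is RH-implied (Suzuki2023 Thm 1.7: RH ⇒ `Ψ ≥ 0`)
and, given this theorem, RH-equivalent.  RH is NOT proved by this file; nothing here bears on the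
truth of RH.

**Proof** = the registered line «quartic chord» (lead prover's skeleton
`Cruxes/QuarticSampleLandau/Lines/quartic_chord.lean`), both stubs landed:
* PRIME SIDE — `SparseScrewLandau.stub_primeSumConvexCombo`
  (`Theorems/SparseScrewLandauQuarticSampleLandauPrimeSumConvex.lean`): the prime sum
  `φ = zetaScrewPrimeSum` is convex on `[0, ∞)` because `Λ ≥ 0`;
* SMOOTH PART — `SparseScrewLandau.stub_smoothPartQuarticDefect`
  (`Theorems/SparseScrewLandauQuarticSampleLandauSmoothDefect.lean`): on the quartic cell
  `[4 log n, 4 log (n+1)] ∋ t` the smooth part `G = Ψ + φ` lies above its chord minus `D = 8`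
  (archimedean chord defect bounded because `(cell length)² · e^{t/2} ≍ (4/n)² (n+1)²` is bounded —
  exactly the quartic threshold; Hurwitz–Lerch part convex; affine part exact);
* COMPOSITION (`QuarticSampleLandau_proof`, from the BC3 birth skeleton of planner rh-idea-6):
  `Ψ(t) = G(t) - φ(t) ≥ [s G(a) + (1-s) G(b) - D] - [s φ(a) + (1-s) φ(b)] = s Ψ(a) + (1-s) Ψ(b) - D ≥ -K - D`
  on `[0, ∞)`, and the tree's RH-free robust Landau detection with constant slack,
  `Literature.NumberTheory.LFunctions.ZetaScrewLandau.riemannHypothesis_of_zetaScrew_ge_neg_const`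
  (Landau–Widder on the Mellin transform of `Ψ∘log + K + D ≥ 0`, Suzuki2023 §7.2 / arXiv:2411.07436
  Prop. 1; the same theorem as `IntegerScrewDiscreteLandau.robustLandau`, imported from Literature to
  keep this file outside every other route's cone) excludes zeros of `ξ(½ + w)` in `Re w > 0`, i.e. RH.

Delta over the tree's `IntegerScrew.DiscreteLandau` (stmt-RiemannHypothesis-15758, every integer `x = m`):
the sample set has density `x^{1/4}`; the one-sided monotonicity argument of `nodeSlack` (prime sum
affine on `(m, m+1)`) is replaced by two-sided chords + convexity of `φ`.
-/

-- `Summit.RiemannHypothesis.RiemannHypothesis.…` repeats a component by the tree's layout (D-0017).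
set_option linter.dupNamespace false

noncomputable section

namespace Summit.RiemannHypothesis.RiemannHypothesis.Theorems

open Literature.NumberTheory.LFunctions
open Summit.RiemannHypothesis.RiemannHypothesis.Theorems.SparseScrewLandau
  (stub_primeSumConvexCombo stub_smoothPartQuarticDefect)

/-- A floor of `Ψ` at the quartic nodes is a floor on `[0, ∞)`: if `Ψ(4 log n) ≥ -K` for all `n ≥ 1`
then `Ψ(t) ≥ -(K + 8)` for all `t ≥ 0` (two-point convexity of the prime sum + chord defect `≤ 8`
of the smooth part on the quartic cell of `t`).  RH-free. -/
theorem SparseScrewLandau.zetaScrew_ge_of_quarticSampleFloor {K : ℝ}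
    (hK : ∀ n : ℕ, 1 ≤ n → -K ≤ zetaScrew (4 * Real.log n)) :
    ∃ D : ℝ, ∀ t : ℝ, 0 ≤ t → -(K + D) ≤ zetaScrew t := by
  obtain ⟨D, hD⟩ := stub_smoothPartQuarticDefect
  refine ⟨D, fun t ht ↦ ?_⟩
  obtain ⟨n, hn, s, hs0, hs1, hts, hG⟩ := hD t ht
  have hn0 : (0 : ℝ) < n := by exact_mod_cast (by omega : 0 < n)
  have hn1 : (1 : ℝ) ≤ n := by exact_mod_cast hn
  have hu : 0 ≤ 4 * Real.log n := by
    have := Real.log_nonneg hn1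
    linarith
  have huv : 4 * Real.log n ≤ 4 * Real.log ((n : ℝ) + 1) := by
    have := Real.log_le_log hn0 (by linarith : (n : ℝ) ≤ (n : ℝ) + 1)
    linarith
  have hφ := stub_primeSumConvexCombo (4 * Real.log n) (4 * Real.log ((n : ℝ) + 1)) s hu huv hs0 hs1
  rw [← hts] at hφ
  have hKn : -K ≤ zetaScrew (4 * Real.log n) := hK n hn
  have hKn1 : -K ≤ zetaScrew (4 * Real.log ((n : ℝ) + 1)) := by
    have h := hK (n + 1) (by omega)
    have hc : ((n + 1 : ℕ) : ℝ) = (n : ℝ) + 1 := by push_cast; ring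
    rw [hc] at h
    exact h
  have hA : s * (-K) ≤ s * zetaScrew (4 * Real.log n) := mul_le_mul_of_nonneg_left hKn hs0
  have hB : (1 - s) * (-K) ≤ (1 - s) * zetaScrew (4 * Real.log ((n : ℝ) + 1)) :=
    mul_le_mul_of_nonneg_left hKn1 (by linarith)
  nlinarith [hA, hB, hφ, hG]

/-- **Crux `SparseScrewLandau.QuarticSampleLandau` (stmt-RiemannHypothesis-23405), quartic-sample
Landau detection (RH-free):** if `Ψ(4 log n) ≥ -K` for some `K` and all `n ≥ 1`, `Ψ` Suzuki's screw
function of `ζ`, then the Riemann Hypothesis holds.  Composition of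
`SparseScrewLandau.zetaScrew_ge_of_quarticSampleFloor` (floor at the quartic nodes ⇒ floor on
`[0, ∞)`) with the tree's robust Landau detection
`ZetaScrewLandau.riemannHypothesis_of_zetaScrew_ge_neg_const` (floor on `[0, ∞)` ⇒ no zero of
`ξ(½ + w)` in `Re w > 0` ⇒ RH).  A criterion, not a proof of RH: the floor itself is the
RH-equivalent residual `QuarticSampleFloor`. -/
theorem QuarticSampleLandau_proof :
    Summit.RiemannHypothesis.RiemannHypothesis.Theses.SparseScrewLandau.QuarticSampleLandau := by
  unfold Summit.RiemannHypothesis.RiemannHypothesis.Theses.SparseScrewLandau.QuarticSampleLandau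
  rintro ⟨K, hK⟩
  obtain ⟨D, hbdd⟩ := SparseScrewLandau.zetaScrew_ge_of_quarticSampleFloor hK
  -- robust Landau detection: `Ψ ≥ -(K + D)` on `[0, ∞)` ⇒ no zero of `ξ(1/2 + ·)` in `Re > 0` ⇒ RH
  exact ZetaScrewLandau.riemannHypothesis_of_zetaScrew_ge_neg_const (K + D) hbdd

end Summit.RiemannHypothesis.RiemannHypothesis.Theorems

end
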